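import Summits.QuantumFields.BalabanUV.Beta.FP.PerfectPolarizationDecay
import Summits.QuantumFields.BalabanUV.Beta.FP.PerfectPolarizationWard
import Summits.QuantumFields.BalabanUV.Beta.FP.WardZerothMomentSextic

/-!
# `BalabanUV.Beta.FP.PerfectPolarizationZerothMoment` — road «FP» for binder row D1, leaf (H2), row **H2-ASM-5** (owner END), module E:
# (K0) FOR THE EXPLICIT KERNEL `PiBF` — ZERO TOTAL MASS OF EVERY ENTRY: `∀ c e, HasSum (PiBF wg wgh V W v w c e) 0`
# = W2's Ward identity `PerfectPolarizationWard.wardTransversal_flip_PiBF` ✓ ∘ leaf-01-g10's FIRST-MOMENT Ward passage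
# `WardZerothMomentSextic.hasSum_zero_of_ward_flip_sextic` ✓ (E-FP-8-3) ∘ module D's (K6) `PerfectPolarizationDecay.sextic_PiBF`

HONEST DEPENDENCY (page 1, mandatory): continuum YM on T⁴ ⇐ BetaPertH ∧ nine spine estimates (0/9 proved); BetaPertH ⇐ (D1) ∧ (D4) ∧
CAP+tail; G-an2-4 gates asym, D1 and NE2/3/4.  HONEST FRAMING (cell contract, verbatim): «discharging `BetaPertH` makes Bałaban's UV
stability UNCONDITIONAL — a real constructive-QFT result; it is NOT the continuum limit and NOT the Clay problem.»  THIS MODULE is a three-line composition BY NAME.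
Hypotheses (displayed): the WARD letters of H2-ASM-5a (bi-localisation of all vertex tables at all base points — ONE localisation constant `Cv` for both cubic families, as module C's engine letter wants —, translation covariance, the (W1)∕(W2) commutator
identities with bi-localised generator tables `X`, `Xg` — letters (a4)∕(a8) of the admissible family, the perfect action's own are H2V-4) and module C's letters (total zero
mass (a3), the germ identities of H2V-1∕2∕3, (W-loc) for both quartic tables).  No `def`, no `def … : Prop`, nothing cited, 0 sorry.  WHAT IT IS: the (K0) letter of the
γ-END (`HorizontalRemainderPerfect.hbook∕hasym_perfect_of_remainder`, `RemainderLedger.…_of_pieces`) at `K := PiBF`; WHAT IT IS NOT: not (Kcov), not hbook∕hasym;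
0∕4 row-D1 binders; NOT D1, NOT BetaPertH, NOT continuum, NOT Clay.

ABSOLUTE RULE (cell charter, verbatim): «No internally-minted statement may enter as a cited fact. Every hypothesis is either kernel-proved in this
package or a verbatim quotation of a PUBLISHED theorem with page reference. The manuscript(s) under audit are NOT citable for their own disputed
steps — they are the thing under adjudication; programme-internal (2001/route/tribunal) claims are never citable.»

Provenance: road FP OWNER b2b-balaban-beta-d1-p3 gen 8 (prover-b2b-balaban-beta-d1-p3-g8-0), 2026-08-21, row H2-ASM-5 module E; «not in print; our bookkeeping».
-/

noncomputable section

namespace Summit.QuantumFields.BalabanUV.Beta.FP.PerfectPolarizationZerothMoment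

open Finset
open scoped BigOperators
open Literature.MathematicalPhysics.QuantumFieldTheory.Balaban1983to89
open Literature.MathematicalPhysics.QuantumFieldTheory.Balaban1983to89.Beta
open B12Sec2to5 (l1)
open PolarizationSign (WardTransversal)
open ExpKernelCalculus (Site MKer BiLoc comp shiftK)
open OneStepResolventKernel (Fib LocStencil)
open OneStepKernelFamily (flipK)
open KernelWard (divV divW)
open DyadicShell (Pt supNorm)
open Summit.QuantumFields.BalabanUV.Beta.FP.WilsonCubicGerm (cubicGermOf)
open Summit.QuantumFields.BalabanUV.Beta.FP.GhostCubicGerm (cubicGermOfSc)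
open Summit.QuantumFields.BalabanUV.Beta.FP.BubbleGermValue (bfGerm ghostGerm)
open Summit.QuantumFields.BalabanUV.Beta.FP.PerfectPolarization (Pker G0ker PiBF)
open Summit.QuantumFields.BalabanUV.Beta.FP.PerfectPolarizationDecay (sextic_PiBF)
open Summit.QuantumFields.BalabanUV.Beta.FP.PerfectPolarizationWard (wardTransversal_flip_PiBF)
open Summit.QuantumFields.BalabanUV.Beta.FP.WardZerothMomentSextic (hasSum_zero_of_ward_flip_sextic)

/-- **(K0) FOR THE EXPLICIT KERNEL `PiBF`** [our object] (row H2-ASM-5, module E): under the Ward letters of H2-ASM-5a and module C's letters,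
EVERY entry of `PiBF wg wgh V W v w` has zero total mass: `∀ c e, HasSum (PiBF … c e) 0`. -/
theorem hK0_PiBF (wg wgh : ℝ)
    {V : Fin 4 → Site 4 → MKer 4 (Fib 3)} {W : Fin 4 → Site 4 → Fin 4 → Site 4 → MKer 4 (Fib 3)}
    {v : Fin 4 → Site 4 → MKer 4 Unit} {w : Fin 4 → Site 4 → Fin 4 → Site 4 → MKer 4 Unit} {Cv Cw Cx Cw' Cx' CwL CwL' cQ δ : ℝ} (hδ : 0 < δ)
    -- the Ward letters (H2-ASM-5a W2's hypotheses, verbatim)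
    (hV : ∀ (μ : Fin 4) (y : Site 4), BiLoc (V μ y) y y Cv δ) (hW : ∀ (μ : Fin 4) (y : Site 4) (ν : Fin 4) (y' : Site 4), BiLoc (W μ y ν y') y y' Cw δ)
    (hcovV : ∀ (μ : Fin 4) (y t : Site 4), V μ (y + t) = shiftK (-t) (V μ y))
    (hcovW : ∀ (μ : Fin 4) (y : Site 4) (ν : Fin 4) (y' t : Site 4), W μ (y + t) ν (y' + t) = shiftK (-t) (W μ y ν y'))
    (X : Site 4 → MKer 4 (Fib 3)) (hX : ∀ y, BiLoc (X y) y y Cx δ)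
    (hW1 : ∀ y, comp (comp Pker (divV V y)) Pker = comp Pker (X y) - comp (X y) Pker)
    (hW2 : ∀ y ν y', divW W y ν y' = comp (X y) (V ν y') - comp (V ν y') (X y))
    (hv : ∀ (μ : Fin 4) (y : Site 4), BiLoc (v μ y) y y Cv δ) (hw : ∀ (μ : Fin 4) (y : Site 4) (ν : Fin 4) (y' : Site 4), BiLoc (w μ y ν y') y y' Cw' δ)
    (hcovv : ∀ (μ : Fin 4) (y t : Site 4), v μ (y + t) = shiftK (-t) (v μ y))
    (hcovw : ∀ (μ : Fin 4) (y : Site 4) (ν : Fin 4) (y' t : Site 4), w μ (y + t) ν (y' + t) = shiftK (-t) (w μ y ν y'))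
    (Xg : Site 4 → MKer 4 Unit) (hXg : ∀ y, BiLoc (Xg y) y y Cx' δ)
    (hW1g : ∀ y, comp (comp G0ker (divV v y)) G0ker = comp G0ker (Xg y) - comp (Xg y) G0ker)
    (hW2g : ∀ y ν y', divW w y ν y' = comp (Xg y) (v ν y') - comp (v ν y') (Xg y))
    -- module C's letters: total zero mass, germ identities, (W-loc)
    (h0V : ∀ (lam α β : Fin 4), ∑' p : Pt × Pt, V lam 0 p.1 p.2 (Sum.inl α) (Sum.inl β) = 0)
    (hgermV : cubicGermOf V = cQ • bfGerm)
    (hWloc : ∀ (μ ν : Fin 4) (z : Pt), BiLoc (W μ 0 ν z) 0 z (CwL * Real.exp (-δ * l1 z)) δ)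
    (h0v : ∀ lam : Fin 4, ∑' p : Pt × Pt, v lam 0 p.1 p.2 () () = 0)
    (hgermv : cubicGermOfSc v = ghostGerm)
    (hwloc : ∀ (μ ν : Fin 4) (z : Pt), BiLoc (w μ 0 ν z) 0 z (CwL' * Real.exp (-δ * l1 z)) δ)
    (c e : Fin 4) : HasSum (PiBF wg wgh V W v w c e) 0 := by
  have hLoc : LocStencil V Cv δ := fun κ u => hV κ u
  have hcovV0 : ∀ (lam : Fin 4) (u : Site 4), V lam u = shiftK (-u) (V lam 0) := fun lam u => by
    have h := hcovV lam 0 u; rwa [zero_add] at h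
  have hcovv0 : ∀ (lam : Fin 4) (u : Site 4), v lam u = shiftK (-u) (v lam 0) := fun lam u => by
    have h := hcovv lam 0 u; rwa [zero_add] at h
  obtain ⟨C, _, hK⟩ := sextic_PiBF (wg := wg) (wgh := wgh) (cQ := cQ) hδ hLoc hcovV0 h0V hgermV hWloc hv hcovv0 h0v hgermv hwloc
  have hWard : WardTransversal (flipK (PiBF wg wgh V W v w)) :=
    wardTransversal_flip_PiBF wg wgh hδ hV hW hcovV hcovW X hX hW1 hW2 hv hw hcovv hcovw Xg hXg hW1g hW2g
  exact hasSum_zero_of_ward_flip_sextic hK hWard c e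

end Summit.QuantumFields.BalabanUV.Beta.FP.PerfectPolarizationZerothMoment

end
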